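import Literature.AlgebraicGeometry.Frobenioids.PadicKummerSetting
import Literature.NumberTheory.GaloisRepresentations.ContinuousH1
import HarnessLib

/-!
# Frobenioids II, Definition 2.2 (ii)(c): the degree-one inflation maps are injective

Mochizuki, *The geometry of Frobenioids II*, Kyushu J. Math. **62** (2008) 401–460, §2, Definition
2.2 (ii) p. 17 [cite: MochizukiFrdII2008, Def 2.2 (ii) p.17]: condition (c) asks that "the natural
surjective homomorphism `H ↠ H_A` induces isomorphisms on first cohomology modules
`H¹(H_A, μ_N(A)) ⥲ H¹(H, μ_N(A))`; `H¹(H_A, ℤ/Nℤ) ⥲ H¹(H, ℤ/Nℤ)` and a surjection on second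
cohomology modules".

Proof-only companion of `KummerReciprocity.lean` / `PadicKummerSetting.lean` (abc-iut-L1-t7): the
maps in question are inflation maps along a SURJECTION `q : H ↠ H_A` for modules on which `H` acts
through `q` (the author's intended reading, *Responses to questions on Frobenioids* (2015) R18:
"`H` acts on `μ_N(A)` via `H → H_A`"), and inflation in degree one is always injective
(inflation–restriction). Hence the "isomorphism" clauses of (c) are equivalent to SURJECTIVITY
clauses:
* `Kummer.oneCocycleClass_eq_of_infl_eq`, `Kummer.infl_one_injective` — for any discrete `H_A`,
  continuous surjection `q : H ↠ H_A` and topological `H_A`-module `X` (carrier in `Type`),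
  `H¹(H_A, X) → H¹(H, X)` is injective (cocycle level, via the tree's `ContinuousH1`: a crossed
  homomorphism `ψ` with `ψ ∘ q` principal is principal);
* `Kummer.isCohSaturated_iff_surjective` — (c) ⟺ the three maps are surjective;
* `PadicKummer.Def22Context.infl_one_injective`, `isNHSaturated_iff_surjective` — the same for
  every Definition 2.2 context `X` (`H ↠ H_A` is surjective by construction, `toHA_surjective`).
No definitions; nothing here concerns [IUTchIII].
-/

namespace Literature.AlgebraicGeometry.Frobenioids

open CategoryTheory Literature.NumberTheory.GaloisRepresentations

namespace Kummer

/-- **Inflation is injective in degree one, cocycle form**: for a discrete group `H_A`, a continuous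
surjective homomorphism `q : H ↠ H_A` and a topological `H_A`-module `X` (on which `H` acts through
`q`), two continuous crossed homomorphisms `ψ, ψ' : H_A → X` whose inflations to `H` are
cohomologous are cohomologous — if `(ψ - ψ') ∘ q = (σ ↦ σ·v - v)` then `ψ - ψ' = (τ ↦ τ·v - v)`
by surjectivity of `q`. (The topology instances on `Γ` are implicit binders, read off the type of
`q`; see the note on topologies in `PadicKummerGaloisFN.lean`.)
[cite: MochizukiFrdII2008, Def 2.2 (ii) p.17] -/
theorem oneCocycleClass_eq_of_infl_eq {Γ : Type} [Group Γ] {_ : TopologicalSpace Γ}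
    {_ : DiscreteTopology Γ} (HA : Subgroup Γ) {H : Type} [Group H] [TopologicalSpace H]
    [IsTopologicalGroup H] (q : H →ₜ* HA) (hq : Function.Surjective q) (X : TopRep ℤ HA)
    (ψ ψ' : contOneCocycles X)
    (h : (infl HA q X 1).hom (oneCocycleClass X ψ) = (infl HA q X 1).hom (oneCocycleClass X ψ')) :
    oneCocycleClass X ψ = oneCocycleClass X ψ' := by
  have hmap : ∀ φ : contOneCocycles X, (infl HA q X 1).hom (oneCocycleClass X φ) =
      oneCocycleClass _ (contOneCocycles.pullback q (𝟙 (TopRep.res (q : H →* HA) X)) φ) :=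
    fun φ => map_oneCocycleClass X q (𝟙 _) φ
  rw [hmap, hmap] at h
  have h0 : oneCocycleClass _ (contOneCocycles.pullback q (𝟙 (TopRep.res (q : H →* HA) X)) ψ -
      contOneCocycles.pullback q (𝟙 (TopRep.res (q : H →* HA) X)) ψ') = 0 := by
    rw [oneCocycleClass_sub, h, sub_self]
  obtain ⟨v, hv⟩ := (oneCocycleClass_eq_zero_iff _ _).mp h0
  rw [← sub_eq_zero, ← oneCocycleClass_sub]
  refine (oneCocycleClass_eq_zero_iff X _).mpr ⟨v, fun τ => ?_⟩
  obtain ⟨σ, rfl⟩ := hq τ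
  have h1 := hv σ
  rw [Submodule.coe_sub, ContinuousMap.sub_apply, contOneCocycles.pullback_apply,
    contOneCocycles.pullback_apply, TopRep.id_apply, TopRep.id_apply] at h1
  rw [Submodule.coe_sub, ContinuousMap.sub_apply]
  exact h1

/-- **Inflation is injective in degree one**: `H¹(H_A, X) → H¹(H, X)` is injective for a surjective
`q : H ↠ H_A` and any topological `H_A`-module `X` with carrier in `Type` (the universe of the groups,
as required by the cocycle description of `H¹`; all modules of [FrdII] §2 live there) — the
injectivity half of the "isomorphisms" of FrdII Def. 2.2 (ii)(c), automatic.
[cite: MochizukiFrdII2008, Def 2.2 (ii) p.17] -/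
theorem infl_one_injective {Γ : Type} [Group Γ] {_ : TopologicalSpace Γ} {_ : DiscreteTopology Γ}
    (HA : Subgroup Γ) {H : Type} [Group H] [TopologicalSpace H] [IsTopologicalGroup H]
    (q : H →ₜ* HA) (hq : Function.Surjective q) (X : TopRep.{0} ℤ HA) :
    Function.Injective (infl HA q X 1).hom := by
  intro a b hab
  obtain ⟨ψ, rfl⟩ := oneCocycleClass_surjective X a
  obtain ⟨ψ', rfl⟩ := oneCocycleClass_surjective X b
  exact oneCocycleClass_eq_of_infl_eq HA q hq X ψ ψ' hab

variable {Γ : Type} [Group Γ] (N : ℕ) (O : Type) [CommMonoid O] [MulDistribMulAction Γ O]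
  (HA : Subgroup Γ) [TopologicalSpace Γ] [DiscreteTopology Γ]
  {H : Type} [Group H] [TopologicalSpace H] [IsTopologicalGroup H] (q : H →ₜ* HA)

/-- **Definition 2.2 (ii)(c) ⟺ surjectivity**: along a surjective `q : H ↠ H_A`, condition (c) is
equivalent to the surjectivity of the three inflation maps (the degree-one injectivity being
automatic, `infl_one_injective`). [cite: MochizukiFrdII2008, Def 2.2 (ii) p.17] -/
theorem isCohSaturated_iff_surjective (hq : Function.Surjective q) :
    IsCohSaturated N O HA q ↔
      Function.Surjective (infl HA q (muTopRep N O HA) 1).hom ∧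
        Function.Surjective (infl HA q (trivTopRep N HA) 1).hom ∧
          Function.Surjective (infl HA q (muTopRep N O HA) 2).hom := by
  constructor
  · rintro ⟨h1, h2, h3⟩
    exact ⟨h1.2, h2.2, h3⟩
  · rintro ⟨h1, h2, h3⟩
    exact ⟨⟨infl_one_injective HA q hq _, h1⟩, ⟨infl_one_injective HA q hq _, h2⟩, h3⟩

end Kummer

namespace PadicKummer

namespace Def22Context

variable (X : Def22Context) (N : ℕ)

/-- For every Definition 2.2 context, `H¹(H_A, M) → H¹(H, M)` is injective for any topological
`H_A`-module `M` (`H ↠ H_A` is surjective, `toHA_surjective`). [cite: MochizukiFrdII2008, Def 2.2 (ii) p.17] -/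
theorem infl_one_injective (M : TopRep.{0} ℤ X.HA) :
    Function.Injective (Kummer.infl X.HA X.qHA M 1).hom :=
  Kummer.infl_one_injective X.HA X.qHA X.toHA_surjective M

/-- **Definition 2.2 (ii)** for a context `X`: `A` is `(N, H)`-saturated iff (a) `μ_N`-saturated,
(b) `A_D` Galois, and the three maps of (c) are SURJECTIVE.
[cite: MochizukiFrdII2008, Def 2.2 (ii) p.17] -/
theorem isNHSaturated_iff_surjective :
    IsNHSaturated X N ↔ Kummer.IsMuSaturated N X.O ∧ X.isGalois ∧
      Function.Surjective (Kummer.infl X.HA X.qHA (Kummer.muTopRep N X.O X.HA) 1).hom ∧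
        Function.Surjective (Kummer.infl X.HA X.qHA (Kummer.trivTopRep N X.HA) 1).hom ∧
          Function.Surjective (Kummer.infl X.HA X.qHA (Kummer.muTopRep N X.O X.HA) 2).hom := by
  rw [isNHSaturated_iff, Kummer.isCohSaturated_iff_surjective N X.O X.HA X.qHA X.toHA_surjective]

end Def22Context

end PadicKummer

end Literature.AlgebraicGeometry.Frobenioids
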